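import Literature.NumberTheory.Rogawski1990.ArchTransfFamilyWeyl        -- ★ p849820 (LH7-p02 (g2)): `negXAt_mem_regG_iff`, `archRG_negXAt` (+ ★ `…Symmetries`: `add_angleShift_mem_regG_iff`, `mem_closure_regG`, `circleExp_angleShift_eq_one`; ★ `ArchHCSpaceG`: `hcSwapAt`, the clauses)
import Literature.NumberTheory.Automorphic.ArchCartanWallExtension     -- ★ (LH3-p01 (g3)): `extendFrom_apply_homeomorph`, `negXHomeomorph` (the `H`-side twin `bzExtend`)
import HarnessLib

/-!
# `hcExtendG s S′ g` — the wall extension of a `G′`-side Cartan function from the `G`-regular set across the COMPACT and REAL walls (`InRegG s S′`), and the transport of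
# Harish-Chandra's clauses (P), (W), (I₄) from the raw family to the extended one (Harish-Chandra ∕ Varadarajan 1977 I §1.12; Bouaziz 1994 §3.1 (I₂); Shelstad 1979 §4)

Topic `NumberTheory/Rogawski1990`; namespace `Literature.NumberTheory.Rogawski1990`.  ONE definition WITH BODY + theorems (no instance, no notation, no axiom, no named fact,
no `sorry`).  Cell `pub/hodgecm-mathlib`, crux H413 (`stmt-HodgeConjecture-24833`), F0∕P3c line LH3 (closer stub `stub_N9`, DIRECT ROAD `F0_P3c_StubN9Direct`): brick
**(G′-EXT)**, generic half (repair R1′ of the (J-CENSUS) §0 finding of LH4-p03 (g4), 2026-09-02: the genuine `G′`-family ★ `orbFamG` is RAW — it vanishes identically on the real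
walls `x_w = 0`, where (I₃)'s Cayley points ★ `hcCayPt` read it and where (I₁) asks smoothness ACROSS; the letter L1 is print-true only for the WALL-EXTENDED family); LH3-p02 (g2).

THE MATHEMATICS.  Harish-Chandra's normalised orbital function `'F_f = |D|^{1∕2} Φ_f` of a Cartan subgroup `T′ ⊂ G′_∞` is defined on the regular set and EXTENDS: continuously
(with all derivatives, from each side) to the semiregular points, smoothly ACROSS the walls of the compact imaginary roots and of the real roots, with jumps only across the
noncompact imaginary walls [Varadarajan1977, I §1.12; Bouaziz 1994 §3.1 (I₂) «`b_Ψ φ` se prolonge en une fonction `C^∞` sur `H_{Ψ-reg}`»].  On the `G′`-charts of ★ (COORD) the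
set across which one extends is ★ `InRegG s S′` (only the noncompact imaginary walls `e^{iθ_i} = e^{iθ_j}`, `s w i ≠ s w j`, removed) and the literal set is ★ `RegG S′`.  So, exactly as
the `H` side does with ★ `bzExtend` ∕ ★ `bzExtendG` (keyed on `InRegS`), the `G′`-side family member attached to a raw function `g` is
**`hcExtendG s S′ g c := if c ∈ RegG S′ then g c else (InRegG s S′).indicator (extendFrom (RegG S′) g) c`** — LITERALLY `g` on `RegG S′`; the `RegG`-limit of `g` (Mathlib
`extendFrom`, where it exists — Harish-Chandra; not assumed) on `InRegG s S′ ∖ RegG S′`; `0` on the noncompact imaginary walls (never read).  KEY POINT (as for ★ `bzExtend`): the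
symmetry clauses need NO limit to exist — `extendFrom` is transported by every homeomorphism preserving `RegG S′` and `g|RegG S′` (★ `extendFrom_apply_homeomorph`), and the
DIVISION-FREE (W) relation with the SIGNED normaliser ★ `archRG` is trivial off `RegG S′` because `archRG S′` VANISHES there (§1 `archRG_eq_zero_of_not_mem_regG`: off `RegG` some
factor `1 − e^{i(θ_j−θ_i)}` or `|e^{x} − e^{−x}|` is `0`) — at `c` and at the swapped point alike.

* §1 KIT: `archRG_eq_zero_of_not_mem_regG`; invariance of ★ `InRegG s S′` under the angle lattice (`add_angleShift_mem_inRegG_iff`), under `x_w ↦ −x_w` at a split place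
  (`negXAt_mem_inRegG_iff`), and of `RegG S′` ∕ `InRegG s S′` under a SAME-SIGN slot transposition at a compact place (`hcSwapAt_mem_regG_iff`, `hcSwapAt_mem_inRegG_iff`; the
  homeomorphism `hcSwapHomeomorph`).
* §2 `hcExtendG` + API: `_of_mem_regG`, `_eqOn_regG`, `_of_mem_inRegG_of_not_mem_regG`, `_of_not_mem_inRegG`, `_congr` (it reads `g` on `RegG S′` only), `_eq_of_tendsto` (T2 limits
  on the dense ★ `RegG`, ★ `mem_closure_regG`), `_of_eventuallyEq_zero`, `_zero`, and the TRANSPORT PRINCIPLE `hcExtendG_apply_homeomorph`.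
* §3 SYMMETRIES from hypotheses on `g|RegG S′` only: `hcExtendG_add_angleShift`, `hcExtendG_negXAt`, **`hcExtendG_hcSwapAt_mul_archRG`** (division-free, unconditional off `RegG`).
* §4 THE CLAUSES TRANSPORTED, for any raw family `F : Finset W → (W → Fin 3 → ℝ) → ℂ`: **`archHcPeriodic_hcExtendG (hF : ArchHcPeriodic F)`**, **`archHcWeyl_hcExtendG (hF : ArchHcWeyl s F)`**,
  **`archHcCompactSupport_hcExtendG (hF : ArchHcCompactSupport F)`** — (P), (W), (I₄) of ★ `ArchHCSpaceG` pass from `F` to `fun S′ => hcExtendG s S′ (F S′)`.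
HONEST LABEL: HC_CM is proved only modulo the 7 printed citations (2 remaining: hLiu418 = `stmt-HodgeConjecture-24832`, h413 = `stmt-HodgeConjecture-24833`) until rung 0 closes;
count-neutral (coordinate bookkeeping: it repairs the currency of letter L1 ∕ organ J, pays nothing by itself).

## References
* [Varadarajan1977] V. S. Varadarajan, *Harmonic Analysis on Real Reductive Groups*, LNM 576 (1977), Part I §1.12 (behaviour of `'F_f` at semiregular points: continuous across
  compact and real walls, jumps across noncompact imaginary walls).
* [Bouaziz1994IntegralesOrbitales] A. Bouaziz, *Intégrales orbitales sur les groupes de Lie réductifs*, Ann. Sci. ÉNS 27 (1994) 573–609, §3.1 p. 579 ((I₁), (I₂)), §6.2 p. 591.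
* [Shelstad1979] D. Shelstad, *Characters and inner forms of a quasi-split group over ℝ*, Compositio Math. 39 (1979), §4 pp. 22–24 (`Φ^{T,1}_f`, (I)–(III)).
* [Rogawski1990] J. D. Rogawski, *Automorphic Representations of Unitary Groups in Three Variables*, Ann. of Math. Stud. 123 (1990), §4.9 Prop. 4.9.1 (a) p. 55, §8.2 p. 118.
-/

set_option autoImplicit false

noncomputable section

open Filter Topology Complex Set Function Real
open Literature.NumberTheory.Automorphic.ArchCartan

namespace Literature.NumberTheory.Rogawski1990

variable {W : Type*}

/-! ## §1 Kit: `archRG` vanishes off `RegG`; invariance of `RegG` ∕ `InRegG` under the three symmetries -/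

section Kit

variable [DecidableEq W]

omit [DecidableEq W] in
/-- `e^{ia} = e^{ib}` kills the signed factor `1 − e^{i(b−a)}` (★ `one_sub_coe_circleExp_sub_ne_zero_iff`). [cite: Shelstad1979, §4 p. 22] -/
theorem one_sub_coe_circleExp_sub_eq_zero {a b : ℝ} (h : Circle.exp a = Circle.exp b) : (1 : ℂ) - (Circle.exp (b - a) : ℂ) = 0 := by
  by_contra h'
  exact ((one_sub_coe_circleExp_sub_ne_zero_iff a b).1 h') h

/-- **`archRG S′` VANISHES OFF THE `G`-REGULAR SET**: if `c ∉ RegG S′`, either two eigenvalue angles agree mod `2π` at a compact place (a factor `1 − e^{i(θ_j−θ_i)}` is `0`) or `x_w = 0`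
at a split place (the factor `|e^{x} − e^{−x}|` is `0`).  (Converse of ★ `archRG_ne_zero_of_mem_regG`.) [cite: Shelstad1979, §4 p. 22] [cite: Rogawski1990, §8.2 p. 118] -/
theorem archRG_eq_zero_of_not_mem_regG [Fintype W] {S' : Finset W} {c : W → Fin 3 → ℝ} (hc : c ∉ RegG S') : archRG S' c = 0 := by
  rw [mem_regG_iff, not_and_or, not_forall, not_forall] at hc
  unfold archRG
  rcases hc with ⟨w, hw⟩ | ⟨w, hw⟩
  · rw [Classical.not_imp] at hw
    obtain ⟨hwS, hinj⟩ := hw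
    refine Finset.prod_eq_zero (Finset.mem_univ w) ?_
    rw [if_neg hwS]
    obtain ⟨a, b, hab, hne⟩ := Function.not_injective_iff.1 hinj
    -- `e^{ic_a} = e^{ic_b}` with `a ≠ b`: the factor of the pair `{a, b}` vanishes
    fin_cases a <;> fin_cases b
    all_goals (first | exact absurd rfl hne | skip)
    · have h : Circle.exp (c w 0) = Circle.exp (c w 1) := hab
      rw [one_sub_coe_circleExp_sub_eq_zero h, zero_mul, zero_mul]
    · have h : Circle.exp (c w 0) = Circle.exp (c w 2) := hab
      rw [one_sub_coe_circleExp_sub_eq_zero h, mul_zero, zero_mul]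
    · have h : Circle.exp (c w 0) = Circle.exp (c w 1) := hab.symm
      rw [one_sub_coe_circleExp_sub_eq_zero h, zero_mul, zero_mul]
    · have h : Circle.exp (c w 1) = Circle.exp (c w 2) := hab
      rw [one_sub_coe_circleExp_sub_eq_zero h, mul_zero]
    · have h : Circle.exp (c w 0) = Circle.exp (c w 2) := hab.symm
      rw [one_sub_coe_circleExp_sub_eq_zero h, mul_zero, zero_mul]
    · have h : Circle.exp (c w 1) = Circle.exp (c w 2) := hab.symm
      rw [one_sub_coe_circleExp_sub_eq_zero h, mul_zero]
  · rw [Classical.not_imp, not_not] at hw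
    obtain ⟨hwS, hx⟩ := hw
    refine Finset.prod_eq_zero (Finset.mem_univ w) ?_
    rw [if_pos hwS, hx, neg_zero, sub_self, abs_zero, zero_mul, zero_mul, Complex.ofReal_zero]

/-- The angle lattice does not move any eigenvalue: `e^{i (c + 2πk·e_{(w,i)}) v j} = e^{i c v j}`. [cite: Shelstad1979, §4 p. 22] -/
theorem circleExp_add_angleShift_apply (c : W → Fin 3 → ℝ) (w : W) (i : Fin 3) (k : ℤ) (v : W) (j : Fin 3) :
    Circle.exp ((c + angleShift w i k) v j) = Circle.exp (c v j) := by
  rw [Pi.add_apply, Pi.add_apply, Circle.exp_add, circleExp_angleShift_eq_one, mul_one]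

/-- **`InRegG s S′` is invariant under the angle lattice** (every wall condition reads eigenvalues `e^{iθ}` only). [cite: Bouaziz1994IntegralesOrbitales, §6.2 p. 591] -/
theorem add_angleShift_mem_inRegG_iff (s : W → Fin 3 → SignType) (S' : Finset W) (c : W → Fin 3 → ℝ) (w : W) (i : Fin 3) (k : ℤ) :
    c + angleShift w i k ∈ InRegG s S' ↔ c ∈ InRegG s S' := by
  simp only [mem_inRegG_iff, circleExp_add_angleShift_apply]

/-- **`InRegG s S′` is invariant under `x_w ↦ −x_w` at a split place** (`InRegG` has no condition at the split places). [cite: Shelstad1979, §4 p. 23] -/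
theorem negXAt_mem_inRegG_iff (s : W → Fin 3 → SignType) {S' : Finset W} {w : W} (hw : w ∈ S') (c : W → Fin 3 → ℝ) :
    negXAt w c ∈ InRegG s S' ↔ c ∈ InRegG s S' := by
  simp only [mem_inRegG_iff]
  refine forall_congr' fun w' => forall_congr' fun hw' => ?_
  have hne : w' ≠ w := fun h => hw' (h ▸ hw)
  rw [negXAt_apply_of_ne hne]

omit [DecidableEq W] in
/-- A same-sign transposition does not change the sign pattern at the place: `s w (swap i j l) = s w l`. [cite: Shelstad1979, §4 p. 23] -/
theorem sign_swap_apply_of_eq {s : W → Fin 3 → SignType} {w : W} {i j : Fin 3} (hs : s w i = s w j) (l : Fin 3) : s w (Equiv.swap i j l) = s w l := by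
  rcases eq_or_ne l i with rfl | hi
  · rw [Equiv.swap_apply_left, hs]
  · rcases eq_or_ne l j with rfl | hj
    · rw [Equiv.swap_apply_right, hs]
    · rw [Equiv.swap_apply_of_ne_of_ne hi hj]

/-- `hcSwapAt w i j` is continuous. [cite: Shelstad1979, §4 p. 23] -/
theorem continuous_hcSwapAt (w : W) (i j : Fin 3) : Continuous (hcSwapAt w i j : (W → Fin 3 → ℝ) → W → Fin 3 → ℝ) := by
  refine continuous_pi fun w' => ?_
  by_cases h : w' = w
  · subst h
    have : (fun c : W → Fin 3 → ℝ => hcSwapAt w' i j c w') = fun c => c w' ∘ ⇑(Equiv.swap i j) := by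
      funext c; funext l; rw [hcSwapAt_apply_self, Function.comp_apply]
    rw [this]
    exact continuous_pi fun l => (continuous_apply (Equiv.swap i j l)).comp (continuous_apply w')
  · have : (fun c : W → Fin 3 → ℝ => hcSwapAt w i j c w') = fun c => c w' := by
      funext c; rw [hcSwapAt_apply_of_ne h]
    rw [this]
    exact continuous_apply w'

/-- `hcSwapAt w i j` as a homeomorphism of the coordinate space (an involution, ★ `hcSwapAt_hcSwapAt`). [cite: Shelstad1979, §4 p. 23] -/
def hcSwapHomeomorph (w : W) (i j : Fin 3) : (W → Fin 3 → ℝ) ≃ₜ (W → Fin 3 → ℝ) where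
  toFun := hcSwapAt w i j
  invFun := hcSwapAt w i j
  left_inv := hcSwapAt_hcSwapAt w i j
  right_inv := hcSwapAt_hcSwapAt w i j
  continuous_toFun := continuous_hcSwapAt w i j
  continuous_invFun := continuous_hcSwapAt w i j

/-- `hcSwapHomeomorph w i j` acts as `hcSwapAt w i j`. [cite: Shelstad1979, §4 p. 23] -/
@[simp] theorem hcSwapHomeomorph_apply (w : W) (i j : Fin 3) (c : W → Fin 3 → ℝ) : hcSwapHomeomorph w i j c = hcSwapAt w i j c := rfl

/-- **`RegG S′` is invariant under a slot transposition at a compact place** (injectivity of `l ↦ e^{i c_w l}` is permutation-invariant; other places untouched).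
[cite: Shelstad1979, §4 p. 22] -/
theorem hcSwapAt_mem_regG_iff (S' : Finset W) {w : W} (hw : w ∉ S') (i j : Fin 3) (c : W → Fin 3 → ℝ) : hcSwapAt w i j c ∈ RegG S' ↔ c ∈ RegG S' := by
  rw [mem_regG_iff, mem_regG_iff]
  refine and_congr (forall_congr' fun w' => forall_congr' fun _ => ?_) (forall_congr' fun w' => forall_congr' fun hw' => ?_)
  · by_cases h : w' = w
    · subst h
      have hfun : (fun l : Fin 3 => Circle.exp (hcSwapAt w' i j c w' l)) = (fun l : Fin 3 => Circle.exp (c w' l)) ∘ ⇑(Equiv.swap i j) := by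
        funext l; rw [Function.comp_apply, hcSwapAt_apply_self]
      rw [hfun]
      exact ⟨fun hinj => fun a b hab => (Equiv.swap i j).symm.injective (hinj (by simpa using hab)), fun hinj => hinj.comp (Equiv.swap i j).injective⟩
    · rw [hcSwapAt_apply_of_ne h]
  · have hne : w' ≠ w := fun h => hw (h ▸ hw')
    rw [hcSwapAt_apply_of_ne hne]

/-- **`InRegG s S′` is invariant under a SAME-SIGN slot transposition at a compact place** (`s w i = s w j`: the transposition permutes the noncompact walls at `w` among
themselves). [cite: Shelstad1979, §4 p. 23] [cite: Bouaziz1994IntegralesOrbitales, §6.2 p. 591] -/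
theorem hcSwapAt_mem_inRegG_iff (s : W → Fin 3 → SignType) (S' : Finset W) {w : W} (hw : w ∉ S') {i j : Fin 3} (hs : s w i = s w j) (c : W → Fin 3 → ℝ) :
    hcSwapAt w i j c ∈ InRegG s S' ↔ c ∈ InRegG s S' := by
  -- one direction for every `c`; the involution gives the other
  have key : ∀ c : W → Fin 3 → ℝ, c ∈ InRegG s S' → hcSwapAt w i j c ∈ InRegG s S' := by
    intro c hc w' hw' a b hab hsab
    by_cases h : w' = w
    · subst h
      rw [hcSwapAt_apply_self, hcSwapAt_apply_self]
      exact hc w' hw' _ _ (fun h' => hab ((Equiv.swap i j).injective h')) (by rwa [sign_swap_apply_of_eq hs, sign_swap_apply_of_eq hs])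
    · rw [hcSwapAt_apply_of_ne h]
      exact hc w' hw' a b hab hsab
  refine ⟨fun h => ?_, key c⟩
  have h' := key _ h
  rwa [hcSwapAt_hcSwapAt] at h'

end Kit

/-! ## §2 The wall extension `hcExtendG` -/

section Extend

open Classical in
/-- **`hcExtendG s S′ g`** — the family member on the `G′`-chart `S′` attached to a raw function `g` given on the `G`-regular set: LITERALLY `g c` on ★ `RegG S′`; on
`InRegG s S′ ∖ RegG S′` — the compact walls `e^{iθ_i} = e^{iθ_j}` (`s w i = s w j`) and the real walls `x_w = 0` — the extension of `g` from `RegG S′` (Mathlib `extendFrom`: the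
`RegG`-limit where it exists — Harish-Chandra's continuous extension of `'F_f`; existence is letter L1's content, not assumed); `0` on the noncompact imaginary walls (off ★
`InRegG s S′`, where the jumps live and values are never read).  The `G′`-twin of ★ `bzExtend` ∕ ★ `bzExtendG`. [cite: Varadarajan1977, I §1.12]
[cite: Bouaziz1994IntegralesOrbitales, §3.1 p. 579; §6.2 p. 591] [cite: Shelstad1979, §4 p. 24] -/
def hcExtendG (s : W → Fin 3 → SignType) (S' : Finset W) (g : (W → Fin 3 → ℝ) → ℂ) : (W → Fin 3 → ℝ) → ℂ :=
  fun c => if c ∈ RegG S' then g c else (InRegG s S').indicator (extendFrom (RegG S') g) c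

variable (s : W → Fin 3 → SignType) (S' : Finset W) (g : (W → Fin 3 → ℝ) → ℂ)

/-- **On the `G`-regular set the family member IS `g`, literally.** [cite: Bouaziz1994IntegralesOrbitales, §3.1 p. 579] -/
theorem hcExtendG_of_mem_regG {c : W → Fin 3 → ℝ} (hc : c ∈ RegG S') : hcExtendG s S' g c = g c := by
  unfold hcExtendG
  rw [if_pos hc]

/-- `hcExtendG s S′ g` and `g` agree on `RegG S′`. [cite: Bouaziz1994IntegralesOrbitales, §3.1 p. 579] -/
theorem hcExtendG_eqOn_regG : EqOn (hcExtendG s S' g) g (RegG S') :=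
  fun _ hc => hcExtendG_of_mem_regG s S' g hc

/-- On `InRegG s S′` off `RegG S′` (compact and real walls) the value is the extension `extendFrom (RegG S′) g`. [cite: Varadarajan1977, I §1.12] [cite: Bouaziz1994IntegralesOrbitales, §3.1 p. 579] -/
theorem hcExtendG_of_mem_inRegG_of_not_mem_regG {c : W → Fin 3 → ℝ} (h1 : c ∈ InRegG s S') (h2 : c ∉ RegG S') :
    hcExtendG s S' g c = extendFrom (RegG S') g c := by
  unfold hcExtendG
  rw [if_neg h2, Set.indicator_of_mem h1]

/-- Off `InRegG s S′` (noncompact imaginary walls) the value is `0`. [cite: Bouaziz1994IntegralesOrbitales, §6.2 p. 591] -/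
theorem hcExtendG_of_not_mem_inRegG {c : W → Fin 3 → ℝ} (h : c ∉ InRegG s S') : hcExtendG s S' g c = 0 := by
  unfold hcExtendG
  rw [if_neg (fun h' => h (regG_subset_inRegG s S' h')), Set.indicator_of_notMem h]

/-- **`hcExtendG s S′ g` reads `g` on `RegG S′` ONLY**: two raw functions agreeing on `RegG S′` have the same extension everywhere (`extendFrom A g` depends on `g|A`).
[cite: Bouaziz1994IntegralesOrbitales, §3.1 p. 579] -/
theorem hcExtendG_congr {g g' : (W → Fin 3 → ℝ) → ℂ} (h : EqOn g g' (RegG S')) : hcExtendG s S' g = hcExtendG s S' g' := by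
  funext c
  by_cases hc : c ∈ RegG S'
  · rw [hcExtendG_of_mem_regG s S' g hc, hcExtendG_of_mem_regG s S' g' hc, h hc]
  · by_cases hci : c ∈ InRegG s S'
    · rw [hcExtendG_of_mem_inRegG_of_not_mem_regG s S' g hci hc, hcExtendG_of_mem_inRegG_of_not_mem_regG s S' g' hci hc]
      unfold extendFrom Filter.limUnder
      rw [Filter.map_congr (eventually_nhdsWithin_of_forall fun a ha => h ha)]
    · rw [hcExtendG_of_not_mem_inRegG s S' g hci, hcExtendG_of_not_mem_inRegG s S' g' hci]

/-- **THE LIMIT, WHERE IT EXISTS, IS THE VALUE**: at a wall point of `InRegG s S′` the family member is the `RegG`-limit of `g` (Mathlib `extendFrom_eq`; ★ `RegG S′` is dense, ★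
`mem_closure_regG`). [cite: Varadarajan1977, I §1.12] [cite: Bouaziz1994IntegralesOrbitales, §3.1 (I₂) p. 579] -/
theorem hcExtendG_eq_of_tendsto [Fintype W] {c : W → Fin 3 → ℝ} (h1 : c ∈ InRegG s S') (h2 : c ∉ RegG S') {ℓ : ℂ} (h : Tendsto g (𝓝[RegG S'] c) (𝓝 ℓ)) :
    hcExtendG s S' g c = ℓ := by
  rw [hcExtendG_of_mem_inRegG_of_not_mem_regG s S' g h1 h2]
  exact extendFrom_eq (mem_closure_regG S' c) h

/-- **A raw function vanishing near `c` has extension `0` at `c`** (regular: literally; wall: the `RegG`-limit of an eventually-zero function; noncompact wall: by definition).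
[cite: Bouaziz1994IntegralesOrbitales, §3.1 p. 579] -/
theorem hcExtendG_of_eventuallyEq_zero [Fintype W] {c : W → Fin 3 → ℝ} (h : g =ᶠ[𝓝 c] fun _ => 0) : hcExtendG s S' g c = 0 := by
  by_cases hc : c ∈ RegG S'
  · rw [hcExtendG_of_mem_regG s S' g hc]
    exact h.self_of_nhds
  · by_cases hci : c ∈ InRegG s S'
    · refine hcExtendG_eq_of_tendsto s S' g hci hc ?_
      exact (tendsto_const_nhds.congr' (h.filter_mono nhdsWithin_le_nhds).symm)
    · exact hcExtendG_of_not_mem_inRegG s S' g hci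

/-- The extension of the zero function is zero. [cite: Bouaziz1994IntegralesOrbitales, §3.1 p. 579] -/
@[simp] theorem hcExtendG_zero [Fintype W] : hcExtendG s S' (fun _ => (0 : ℂ)) = fun _ => 0 := by
  funext c
  exact hcExtendG_of_eventuallyEq_zero s S' _ EventuallyEq.rfl

/-- **TRANSPORT PRINCIPLE**: a homeomorphism of the coordinate space preserving `RegG S′`, `InRegG s S′` and `g` on `RegG S′` preserves `hcExtendG s S′ g` at EVERY point (regular:
literally; compact∕real wall: ★ `extendFrom_apply_homeomorph`, no limit needed; noncompact wall: `0 = 0`). [cite: Bouaziz1994IntegralesOrbitales, §3.1 p. 579] [cite: Shelstad1979, §4 p. 22] -/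
theorem hcExtendG_apply_homeomorph (φ : (W → Fin 3 → ℝ) ≃ₜ (W → Fin 3 → ℝ))
    (hR : ∀ x, φ x ∈ RegG S' ↔ x ∈ RegG S') (hI : ∀ x, φ x ∈ InRegG s S' ↔ x ∈ InRegG s S') (hg : ∀ a ∈ RegG S', g (φ a) = g a) (c : W → Fin 3 → ℝ) :
    hcExtendG s S' g (φ c) = hcExtendG s S' g c := by
  by_cases hcr : c ∈ RegG S'
  · rw [hcExtendG_of_mem_regG s S' g hcr, hcExtendG_of_mem_regG s S' g ((hR c).2 hcr), hg c hcr]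
  · by_cases hc : c ∈ InRegG s S'
    · rw [hcExtendG_of_mem_inRegG_of_not_mem_regG s S' g hc hcr,
        hcExtendG_of_mem_inRegG_of_not_mem_regG s S' g ((hI c).2 hc) (fun h => hcr ((hR c).1 h))]
      exact extendFrom_apply_homeomorph φ hR hg c
    · rw [hcExtendG_of_not_mem_inRegG s S' g hc, hcExtendG_of_not_mem_inRegG s S' g (fun h => hc ((hI c).1 h))]

end Extend

/-! ## §3 The three symmetries, from hypotheses on `g|RegG S′` only -/

section Symmetries

variable [Fintype W] [DecidableEq W] (s : W → Fin 3 → SignType) (S' : Finset W) (g : (W → Fin 3 → ℝ) → ℂ)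

omit [Fintype W] in
/-- **(P) TRANSPORT**: if `g` is `2π`-periodic on `RegG S′` in an angle slot (`w ∉ S′ ∨ i ≠ 0`), so is `hcExtendG s S′ g` — EVERYWHERE (★ `add_angleShift_mem_regG_iff`,
`add_angleShift_mem_inRegG_iff`). [cite: Shelstad1979, §4 p. 22] -/
theorem hcExtendG_add_angleShift {w : W} {i : Fin 3} (h : w ∉ S' ∨ i ≠ 0) (k : ℤ) (hg : ∀ c ∈ RegG S', g (c + angleShift w i k) = g c) (c : W → Fin 3 → ℝ) :
    hcExtendG s S' g (c + angleShift w i k) = hcExtendG s S' g c := by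
  have key := hcExtendG_apply_homeomorph s S' g (Homeomorph.addRight (angleShift w i k))
    (fun x => add_angleShift_mem_regG_iff S' x h k) (fun x => add_angleShift_mem_inRegG_iff s S' x w i k) hg c
  simpa only [Homeomorph.coe_addRight] using key

/-- **(W)-REAL TRANSPORT**: if `g` is even under `x_w ↦ −x_w` on `RegG S′` (`w ∈ S′`), so is `hcExtendG s S′ g` — everywhere (★ `negXAt_mem_regG_iff`, `negXAt_mem_inRegG_iff`,
★ `negXHomeomorph`). [cite: Shelstad1979, §4 p. 23] -/
theorem hcExtendG_negXAt {w : W} (hw : w ∈ S') (hg : ∀ c ∈ RegG S', g (negXAt w c) = g c) (c : W → Fin 3 → ℝ) :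
    hcExtendG s S' g (negXAt w c) = hcExtendG s S' g c :=
  hcExtendG_apply_homeomorph s S' g (negXHomeomorph w) (fun x => negXAt_mem_regG_iff S' hw x) (fun x => negXAt_mem_inRegG_iff s hw x) hg c

/-- **(W)-COMPACT, DIVISION-FREE, UNCONDITIONAL OFF `RegG`**: for a slot transposition at a compact place (`w ∉ S′`; same-sign or not), if the raw `g` satisfies
`g (swap c) · R′(c) = R′(swap c) · g c` on `RegG S′` then `hcExtendG s S′ g` satisfies it at EVERY `c` — on `RegG S′` literally, off `RegG S′` because the SIGNED normaliser ★
`archRG S′` vanishes at `c` AND at the swapped point (§1).  No continuity, no limit. [cite: Shelstad1979, §4 p. 23] [cite: Bouaziz1994IntegralesOrbitales, §6.2 p. 591] -/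
theorem hcExtendG_hcSwapAt_mul_archRG {w : W} (hw : w ∉ S') {i j : Fin 3}
    (hg : ∀ c ∈ RegG S', g (hcSwapAt w i j c) * archRG S' c = archRG S' (hcSwapAt w i j c) * g c) (c : W → Fin 3 → ℝ) :
    hcExtendG s S' g (hcSwapAt w i j c) * archRG S' c = archRG S' (hcSwapAt w i j c) * hcExtendG s S' g c := by
  by_cases hc : c ∈ RegG S'
  · rw [hcExtendG_of_mem_regG s S' g hc, hcExtendG_of_mem_regG s S' g ((hcSwapAt_mem_regG_iff S' hw i j c).2 hc), hg c hc]
  · rw [archRG_eq_zero_of_not_mem_regG hc, archRG_eq_zero_of_not_mem_regG (fun h => hc ((hcSwapAt_mem_regG_iff S' hw i j c).1 h)), mul_zero, zero_mul]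

omit [Fintype W] in
/-- Plain swap invariance under a SAME-SIGN transposition (for a raw `g` that is swap-invariant on `RegG S′`), everywhere. [cite: Shelstad1979, §4 p. 23] -/
theorem hcExtendG_hcSwapAt {w : W} (hw : w ∉ S') {i j : Fin 3} (hs : s w i = s w j) (hg : ∀ c ∈ RegG S', g (hcSwapAt w i j c) = g c) (c : W → Fin 3 → ℝ) :
    hcExtendG s S' g (hcSwapAt w i j c) = hcExtendG s S' g c :=
  hcExtendG_apply_homeomorph s S' g (hcSwapHomeomorph w i j) (fun x => hcSwapAt_mem_regG_iff S' hw i j x) (fun x => hcSwapAt_mem_inRegG_iff s S' hw hs x) hg c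

end Symmetries

/-! ## §4 The clauses (P), (W), (I₄) pass from a raw family to its wall extension -/

section Clauses

variable [Fintype W] [DecidableEq W] (s : W → Fin 3 → SignType) (F : Finset W → (W → Fin 3 → ℝ) → ℂ)

omit [Fintype W] in
/-- **(P) for the extended family** from (P) for the raw one. [cite: Shelstad1979, §4 p. 22] [cite: Bouaziz1994IntegralesOrbitales, §3.1 p. 579] -/
theorem archHcPeriodic_hcExtendG (hF : ArchHcPeriodic F) : ArchHcPeriodic fun S' => hcExtendG s S' (F S') :=
  fun S' c _ _ k h => hcExtendG_add_angleShift s S' (F S') h k (fun c' _ => hF S' c' _ _ k h) c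

/-- **(W) for the extended family** from (W) for the raw one (compact half division-free and unconditional off `RegG`, real half by transport).
[cite: Shelstad1979, §4 p. 23] [cite: Bouaziz1994IntegralesOrbitales, §3.1 p. 579; §6.2 p. 591] -/
theorem archHcWeyl_hcExtendG (hF : ArchHcWeyl s F) : ArchHcWeyl s fun S' => hcExtendG s S' (F S') :=
  ⟨fun S' c w i j hw hij hs => hcExtendG_hcSwapAt_mul_archRG s S' (F S') hw (fun c' _ => hF.1 S' c' w i j hw hij hs) c,
    fun S' c w hw => hcExtendG_negXAt s S' (F S') hw (fun c' _ => hF.2 S' c' w hw) c⟩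

omit [DecidableEq W] in
/-- **(I₄) for the extended family** from (I₄) for the raw one, with the SAME bound: beyond it the raw member vanishes on an OPEN set, so its extension vanishes too
(`hcExtendG_of_eventuallyEq_zero`). [cite: Bouaziz1994IntegralesOrbitales, §3.1 (I₄) p. 579] -/
theorem archHcCompactSupport_hcExtendG (hF : ArchHcCompactSupport F) : ArchHcCompactSupport fun S' => hcExtendG s S' (F S') := by
  intro S'
  obtain ⟨Rb, hRb⟩ := hF S'
  refine ⟨Rb, fun c hc => ?_⟩
  obtain ⟨w, hwS, hw⟩ := hc
  apply hcExtendG_of_eventuallyEq_zero s S' (F S')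
  -- `{c′ | Rb < |c′ w 0|}` is an open neighbourhood of `c` on which `F S′` vanishes
  have hopen : IsOpen {c' : W → Fin 3 → ℝ | Rb < |c' w 0|} :=
    isOpen_lt continuous_const (continuous_abs.comp ((continuous_apply 0).comp (continuous_apply w)))
  filter_upwards [hopen.mem_nhds hw] with c' hc'
  exact hRb c' ⟨w, hwS, hc'⟩

end Clauses

end Literature.NumberTheory.Rogawski1990

end
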